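import Literature.NumberTheory.GaloisCohomology.Howard2004.DVRSettingLevelConditionsCocartesianProofs
import Literature.NumberTheory.GaloisCohomology.Howard2004.DVRSettingLevelConditionsCartesianProofs
import Literature.NumberTheory.GaloisCohomology.PoitouTateSha
import Literature.NumberTheory.GaloisRepresentations.ContinuousCohomologyBocksteinFunctorial
import Literature.NumberTheory.GaloisRepresentations.ContinuousCohomologyConnecting
import HarnessLib

/-!
# Howard 2004, Prop. 1.4.1 — the `Ш²`-STEP of the left kernel, pairing-free: the lifting obstruction
# `δ a ∈ H²(K, N_0)` of an `𝓕(n)`-Selmer class `a ∈ H¹(K, T^{(t)})` along `0 → N_0 →ι T^{(t+1)} →red T^{(t)} → 0`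
# lies in `Ш²(K, N_0)`; `a` has a global lift iff `δ a` pairs to zero with `Ш¹(K, N_0^*)` (proofs file)

Topic `NumberTheory/GaloisCohomology/Howard2004` (cell `pub/bsd-print-x9`, cone of the cite-only Flach leaf C45.1′/C45.1″ =
Howard Prop. 1.4.1; seat `bsd-line-x10b-p1-w2` g18, brick «C451-SHA2-STEP»; companion of x10b-p1-w8's
`TowerSelmerLiftGlobalDualityProofs` (LIFT-PT: the Poitou–Tate-for-Selmer-structures half, for classes WITH a global lift)
and of this seat's `DVRSettingLevelConditionsCocartesianProofs` (the local Selmer lifts)).  THEOREMS ONLY: no definition, no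
named fact, no instance, no notation, no `sorry`.

SOURCE.  B. Howard, *The Heegner point Kolyvagin system*, Compositio Math. **140** (2004) = arXiv:1202.6340, Prop. 1.4.1
(p. 8 L83–98: «whose kernels on the left and right are the images of `H¹_𝓕(K, T/𝔪^{s+t}T) → H¹_𝓕(K, T/𝔪^sT)` […] a
straightforward modification of the methods of [Flach]»).  M. Flach, *A generalisation of the Cassels–Tate pairing*, J.
reine angew. Math. **412** (1990), proof of Thm. 1; A. Morgan–A. Smith, arXiv:2103.08530, Prop. 3.5 (proof): a class `a`
pairing to zero pairs to zero in particular with `Ш¹(K, M₁^∨)`, on which the pairing is the Poitou–Tate pairing against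
the obstruction `δa ∈ Ш²(K, M₁)` (that `δa` IS in `Ш²` because `a` is a Selmer class and the local conditions are exact
along the sequence — Howard's display (2), p. 8 L22–30); by the perfectness of `Ш² × Ш¹ → ℚ/ℤ` (Poitou–Tate, Milne I 4.10 /
Harari 17.13) `δa = 0`, so `a` has a global lift, and then the Selmer-structure duality (LIFT-PT) finishes.

THE SETTING (as in LIFT-PT).  A `DVRSetting` `S`; levels `i ≤ t + 1`; a finite set of primes `n`; the short exact sequence
`0 → N_0 →ι N_{t+1} →red N_i → 0` through ANY pair of morphisms of discrete `Γ_K`-modules `f`, `g` that ARE a module map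
`ι` and the reduction `redLE` on elements (`hf`, `hg`) and form a short exact sequence (`h : IsSES f g`; for the pinned
transition of `DVRSettingLevelConditionsCartesianProofs.exists_linearMap_comp_redLE_eq` this is `injective_of_comp_redLE_eq` +
`redLE_eq_zero_iff_mem_range_of_comp_redLE_eq`), with its CANONICAL connecting homomorphism
`h.δ₁ : H¹(K, N_i) → H²(K, N_0)` (tree `ContinuousCohomologyConnecting`).

* §1 `exists_redLEH1_eq_iff_δ₁_eq_zero` — `a ∈ H¹(red)(H¹(K, N_{t+1})) ↔ δ a = 0` (long exact sequence; no hypothesis).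
* §2 **`localization_δ₁_eq_zero_of_mem_selmerGroup_atLevel`** / **`δ₁_mem_shaTwo_of_mem_selmerGroup_atLevel`** — for
  `a ∈ H¹_{𝓕(n)}(K, N_i)` (`hy`, `hu : ¬ p ∣ #𝓞_K^×`, `n ⊆ 𝓛^{(t+1)}`): `loc_v (δ a) = 0` at EVERY place, i.e. `δ a ∈ Ш²(K, N_0)`
  (naturality of `δ` under restriction to `Γ_{K_v}`, `IsSES.pullH_δ₁`, and the local Selmer lift `loc_v a = red_v ℓ_v` of
  `DVRSetting.exists_mem_atLevel_cond_redLELoc_eq_localization`, so that `δ_v (loc_v a) = δ_v (red_v ℓ_v) = 0`).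
* §4 `isSES_of_comp_redLE_eq` — the hypotheses `h : IsSES f g`, `hg := fun _ => rfl` hold for every PINNED transition
  `ι : T^{(i)} → T^{(j)}` with `e_i + e_{i'} = e_j` (`DVRSettingLevelConditionsCartesianProofs`), e.g. `(0, t+1, t)` on a full tower.
* §3 **`exists_redLEH1_eq_iff_forall_pairing_δ₁_eq_zero`** — for any INJECTIVE bi-additive
  `b : Ш²(K, N_0) → Hom(Ш¹(K, N_0^∨(1)), ℤ/n₀)` (the Poitou–Tate pairing of the tree's fact `poitouTate_sha_tateDual`, kernel
  Summits-side: `PoitouTateReduction.poitouTate_sha_tateDual_holds`): `a` has a global lift iff `b (δ a) y = 0` for every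
  `y ∈ Ш¹(K, N_0^∨(1))` — the `Ш²`-step as a CRITERION; what a port still owes here is only the cochain identity «the pairing
  restricted to `Ш¹` is `b (δ a)`» (MS Prop. 3.5, second display).

HONEST FRAMING: no pairing is constructed; Prop. 1.4.1, C45.1′/C45.1″ and `thm161_dvrKolyvaginBound` are NOT proved; no
summit statement is proved; BSD is not proved by any of this.

References: [Howard2004HeegnerKolyvagin] Prop. 1.4.1 and §1.4 display (2) (arXiv:1202.6340 p. 8 L22–30, L83–98);
[Flach1990] proof of Thm. 1; [MilneADT2006] I Thm. 4.10, I Lemma 4.8; [Harari2020] Thm. 17.13; [SerreGaloisCohomology1997]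
I §2.2–§2.4.
-/

set_option autoImplicit false

noncomputable section

namespace Literature.NumberTheory.GaloisCohomology.Howard2004

open Function NumberField IsDedekindDomain Field CategoryTheory
open scoped NumberField ContRepresentation
open Literature.NumberTheory.GaloisRepresentations
open Literature.NumberTheory.GaloisRepresentations.DiscreteGaloisModule

-- Connecting maps need `LocallyCompactSpace Γ_K`: the compactness of the absolute Galois group enters as an instance
-- BINDER `[CompactSpace (absoluteGaloisGroup K)]` of the statements that mention `δ₁` (discharged by the tree's theorem
-- `absoluteGaloisGroup_compactSpace K` at every use), never as an instance attribute.

namespace DVRSetting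

variable {p : ℕ} [Fact p.Prime] {K : Type} [Field K] [NumberField K]
  {R : Type} [CommRing R] [IsDomain R] [IsDiscreteValuationRing R] [Algebra ℤ_[p] R]
  {N : ℕ → Type} [∀ k, AddCommGroup (N k)] [∀ k, TopologicalSpace (N k)]
  [∀ k, DiscreteTopology (N k)] [∀ k, Module R (N k)]
  {Rk : ℕ → Type} [∀ k, CommRing (Rk k)] [∀ k, IsLocalRing (Rk k)] [∀ k, TopologicalSpace (Rk k)]
  [∀ k, DiscreteTopology (Rk k)] [∀ k, Algebra ℤ_[p] (Rk k)] [∀ k, Algebra R (Rk k)]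
  [∀ k, Module (Rk k) (N k)] [∀ k, IsScalarTower R (Rk k) (N k)]
  {Nbar : Type} [AddCommGroup Nbar] [TopologicalSpace Nbar] [DiscreteTopology Nbar]
  [∀ k, Module (Rk k) Nbar]
  {Nq : ℕ → Finset (HeightOneSpectrum (𝓞 K)) → Type} [∀ k n, AddCommGroup (Nq k n)]
  [∀ k n, TopologicalSpace (Nq k n)] [∀ k n, DiscreteTopology (Nq k n)]
  [∀ k n, Module (Rk k) (Nq k n)] [∀ k n, Module R (Nq k n)]
  [∀ k n, IsScalarTower R (Rk k) (Nq k n)]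

/-! ## §1 `a` lifts globally iff its obstruction `δ a` vanishes (long exact sequence) -/

/-- `H¹(g) = H¹(redLE)` when `g` is `redLE` on elements. [cite: SerreGaloisCohomology1997, Ch. I §2.2] -/
theorem cohomologyMap_eq_redLEH1_of_hom_eq (S : DVRSetting p K R N Rk Nbar Nq) {i j : ℕ} (hij : i ≤ j)
    (g : (S.T.ρ j).toTopRep ⟶ (S.T.ρ i).toTopRep) (hg : ∀ y, g.hom y = S.T.redLE hij y)
    (c : galoisCohomology (S.T.ρ j) 1) : _root_.Literature.NumberTheory.GaloisRepresentations.cohomologyMap g 1 c = S.redLEH1 hij c := by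
  obtain ⟨z, rfl⟩ := oneCocycleClass_surjective (S.T.ρ j).toTopRep c
  rw [_root_.Literature.NumberTheory.GaloisRepresentations.cohomologyMap_oneCocycleClass, redLEH1_apply, cohomologyMap_one_oneCocycleClass]
  refine congrArg _ (Subtype.ext (ContinuousMap.ext fun σ => ?_))
  rw [_root_.Literature.NumberTheory.GaloisRepresentations.pullback_id_resIdHom_apply, contOneCocycles.pullback_apply, hg]
  rfl

/-- **`a ∈ H¹(red)(H¹(K, N_{t+1})) ↔ δ a = 0`** for the canonical connecting map of a short exact sequence
`0 → N_0 →f N_{j} →g N_i → 0` of discrete `Γ_K`-modules with `g = redLE` on elements (exactness of the long exact sequence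
at `H¹(K, N_i)`). [cite: Howard2004HeegnerKolyvagin, Prop. 1.4.1 (arXiv:1202.6340 p. 8 L94–98: «the images of H¹(K, T/𝔪^{s+t}T) → H¹(K, T/𝔪^sT)»)]
[cite: SerreGaloisCohomology1997, Ch. I §2.2] -/
theorem exists_redLEH1_eq_iff_δ₁_eq_zero [CompactSpace (absoluteGaloisGroup K)] (S : DVRSetting p K R N Rk Nbar Nq)
    {i j : ℕ} (hij : i ≤ j)
    {f : (S.T.ρ 0).toTopRep ⟶ (S.T.ρ j).toTopRep} {g : (S.T.ρ j).toTopRep ⟶ (S.T.ρ i).toTopRep}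
    (h : IsSES f g) (hg : ∀ y, g.hom y = S.T.redLE hij y) (a : galoisCohomology (S.T.ρ i) 1) :
    (∃ c : galoisCohomology (S.T.ρ j) 1, S.redLEH1 hij c = a) ↔ h.δ₁ a = 0 := by
  constructor
  · rintro ⟨c, rfl⟩
    rw [← S.cohomologyMap_eq_redLEH1_of_hom_eq hij g hg c]
    exact h.δ₁_map_one c
  · intro ha
    obtain ⟨c, hc⟩ := h.exists_map_one_eq_of_δ₁_eq_zero a ha
    exact ⟨c, by rw [← S.cohomologyMap_eq_redLEH1_of_hom_eq hij g hg c]; exact hc⟩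

/-! ## §2 The obstruction of an `𝓕(n)`-Selmer class is everywhere locally trivial -/

/-- Localisation is the pull-back along `Γ_{K_v} → Γ_K`. [cite: SerreGaloisCohomology1997, Ch. II §6.1] -/
theorem localization_eq_pullH (S : DVRSetting p K R N Rk Nbar Nq) (j : ℕ) (v : Place K) (m : ℕ)
    (c : galoisCohomology (S.T.ρ j) m) :
    galoisCohomology.localization (S.T.ρ j) v m c =
      pullH (absGaloisRestrict K (Place.Completion v)) (S.T.ρ j) m c := rfl

/-- **`loc_v (δ a) = 0` at every place for an `𝓕(n)`-Selmer class `a ∈ H¹_{𝓕(n)}(K, N_i)`** (`i ≤ t+1`, `n ⊆ 𝓛^{(t+1)}`,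
`p ∤ #𝓞_K^×`), for the connecting map of `0 → N_0 → N_{t+1} →red N_i → 0`: `loc_v a = red_v ℓ_v` for a local Selmer lift
`ℓ_v ∈ 𝓕(n)_{t+1,v}` (Howard's display (2): `DVRSetting.exists_mem_atLevel_cond_redLELoc_eq_localization`), and
`δ_v ∘ red_v = 0`, `loc_v ∘ δ = δ_v ∘ loc_v` (`IsSES.pullH_δ₁`).
[cite: Howard2004HeegnerKolyvagin, §1.4 display (2) and Prop. 1.4.1 (arXiv:1202.6340 p. 8 L22–30, L83–98)]
[cite: Flach1990, proof of Thm. 1] [cite: SerreGaloisCohomology1997, Ch. I §2.4] -/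
theorem localization_δ₁_eq_zero_of_mem_selmerGroup_atLevel [CompactSpace (absoluteGaloisGroup K)]
    (S : DVRSetting p K R N Rk Nbar Nq) (hy : S.SatisfiesH)
    (hu : ¬ p ∣ Nat.card (𝓞 K)ˣ) {i t : ℕ} (hit : i ≤ t + 1) {n : Finset (HeightOneSpectrum (𝓞 K))}
    (hn : ↑n ⊆ S.levelPrimes (t + 1))
    {f : (S.T.ρ 0).toTopRep ⟶ (S.T.ρ (t + 1)).toTopRep} {g : (S.T.ρ (t + 1)).toTopRep ⟶ (S.T.ρ i).toTopRep}
    (h : IsSES f g) (hg : ∀ y, g.hom y = S.T.redLE hit y)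
    {a : galoisCohomology (S.T.ρ i) 1} (ha : a ∈ (((S.t i).atLevel S.jbar n).cond).selmerGroup) (v : Place K) :
    galoisCohomology.localization (S.T.ρ 0) v 2 (h.δ₁ a) = 0 := by
  obtain ⟨ℓv, -, hℓ⟩ := S.exists_mem_atLevel_cond_redLELoc_eq_localization hy hu hit hn ha v
  haveI : CompactSpace (absoluteGaloisGroup (Place.Completion v)) := absoluteGaloisGroup_compactSpace _
  set θ := absGaloisRestrict K (Place.Completion v) with hθ
  rw [localization_eq_pullH, h.pullH_δ₁ θ a]
  have hloc : pullH θ (S.T.ρ i) 1 a =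
      _root_.Literature.NumberTheory.GaloisRepresentations.cohomologyMap (pullHom θ g) 1 ℓv := by
    obtain ⟨z, rfl⟩ := oneCocycleClass_surjective _ ℓv
    refine Eq.trans ?_
      (_root_.Literature.NumberTheory.GaloisRepresentations.cohomologyMap_oneCocycleClass (pullHom θ g) z).symm
    change galoisCohomology.localization (S.T.ρ i) v 1 a = _
    rw [← hℓ]
    refine (cohomologyMap_one_oneCocycleClass ((S.T.ρ (t + 1)).toLocal v) ((S.T.ρ i).toLocal v)
      (S.T.redLE hit).toAddMonoidHom (fun _ x => S.T.redLE_equivariant hit _ x) z).trans ?_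
    refine congrArg _ (Subtype.ext (ContinuousMap.ext fun σ => ?_))
    rw [contOneCocycles.pullback_apply,
      _root_.Literature.NumberTheory.GaloisRepresentations.pullback_id_resIdHom_apply, pullHom_hom_apply, hg]
    rfl
  rw [hloc]
  exact (h.pull θ).δ₁_map_one ℓv

/-- **`δ a ∈ Ш²(K, N_0)`** for an `𝓕(n)`-Selmer class `a` (same hypotheses): the lifting obstruction of a Selmer class is
everywhere locally trivial. [cite: Howard2004HeegnerKolyvagin, §1.4 display (2) and Prop. 1.4.1 (arXiv:1202.6340 p. 8 L22–30, L83–98)]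
[cite: Flach1990, proof of Thm. 1] [cite: MilneADT2006, I §4 (Ш²) and I Thm. 4.10] -/
theorem δ₁_mem_shaTwo_of_mem_selmerGroup_atLevel [CompactSpace (absoluteGaloisGroup K)]
    (S : DVRSetting p K R N Rk Nbar Nq) (hy : S.SatisfiesH)
    (hu : ¬ p ∣ Nat.card (𝓞 K)ˣ) {i t : ℕ} (hit : i ≤ t + 1) {n : Finset (HeightOneSpectrum (𝓞 K))}
    (hn : ↑n ⊆ S.levelPrimes (t + 1))
    {f : (S.T.ρ 0).toTopRep ⟶ (S.T.ρ (t + 1)).toTopRep} {g : (S.T.ρ (t + 1)).toTopRep ⟶ (S.T.ρ i).toTopRep}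
    (h : IsSES f g) (hg : ∀ y, g.hom y = S.T.redLE hit y)
    {a : galoisCohomology (S.T.ρ i) 1} (ha : a ∈ (((S.t i).atLevel S.jbar n).cond).selmerGroup) :
    h.δ₁ a ∈ shaTwo (S.T.ρ 0) :=
  (mem_shaTwo_iff _ _).2 fun v => S.localization_δ₁_eq_zero_of_mem_selmerGroup_atLevel hy hu hit hn h hg ha v

/-! ## §3 The criterion: `a` lifts globally iff `δ a` pairs to zero with `Ш¹(K, N_0^∨(1))` -/

/-- **The `Ш²`-step of Prop. 1.4.1's left kernel as a criterion.**  For an `𝓕(n)`-Selmer class `a ∈ H¹_{𝓕(n)}(K, N_i)`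
(`i ≤ t+1`, `n ⊆ 𝓛^{(t+1)}`, `p ∤ #𝓞_K^×`) and ANY injective additive `b : Ш²(K, N_0) → Hom(Ш¹(K, N_0^∨(1)), ℤ/n₀)` (the
Poitou–Tate pairing of `poitouTate_sha_tateDual`, bijective — kernel Summits-side): `a` is the reduction of a GLOBAL class
of `H¹(K, N_{t+1})` iff `b (δ a) y = 0` for every `y ∈ Ш¹(K, N_0^∨(1))`.  (Then LIFT-PT decides whether the lift can be taken
in `H¹_{𝓕(n)}(K, N_{t+1})`.)
[cite: Howard2004HeegnerKolyvagin, Prop. 1.4.1 (arXiv:1202.6340 p. 8 L83–98)] [cite: Flach1990, proof of Thm. 1]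
[cite: MilneADT2006, I Thm. 4.10] [cite: Harari2020, Thm. 17.13] -/
theorem exists_redLEH1_eq_iff_forall_pairing_δ₁_eq_zero [CompactSpace (absoluteGaloisGroup K)]
    (S : DVRSetting p K R N Rk Nbar Nq) (hy : S.SatisfiesH)
    (hu : ¬ p ∣ Nat.card (𝓞 K)ˣ) {i t : ℕ} (hit : i ≤ t + 1) {n : Finset (HeightOneSpectrum (𝓞 K))}
    (hn : ↑n ⊆ S.levelPrimes (t + 1))
    {f : (S.T.ρ 0).toTopRep ⟶ (S.T.ρ (t + 1)).toTopRep} {g : (S.T.ρ (t + 1)).toTopRep ⟶ (S.T.ρ i).toTopRep}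
    (h : IsSES f g) (hg : ∀ y, g.hom y = S.T.redLE hit y)
    {a : galoisCohomology (S.T.ρ i) 1} (ha : a ∈ (((S.t i).atLevel S.jbar n).cond).selmerGroup)
    [Finite (N 0)] {n₀ : ℕ} {C : Type*} [AddCommGroup C] (b : shaTwo (S.T.ρ 0) →+ sha ((S.T.ρ 0).tateDual n₀) →+ C)
    (hb : Function.Injective b) :
    (∃ c : galoisCohomology (S.T.ρ (t + 1)) 1, S.redLEH1 hit c = a) ↔
      ∀ y : sha ((S.T.ρ 0).tateDual n₀),
        b ⟨h.δ₁ a, S.δ₁_mem_shaTwo_of_mem_selmerGroup_atLevel hy hu hit hn h hg ha⟩ y = 0 := by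
  rw [S.exists_redLEH1_eq_iff_δ₁_eq_zero hit h hg a]
  constructor
  · intro h0 y
    have hz : (⟨h.δ₁ a, S.δ₁_mem_shaTwo_of_mem_selmerGroup_atLevel hy hu hit hn h hg ha⟩ : shaTwo (S.T.ρ 0)) = 0 :=
      Subtype.ext h0
    rw [hz, map_zero, AddMonoidHom.zero_apply]
  · intro hall
    have hz : b ⟨h.δ₁ a, S.δ₁_mem_shaTwo_of_mem_selmerGroup_atLevel hy hu hit hn h hg ha⟩ = 0 :=
      AddMonoidHom.ext hall
    have := hb (hz.trans (map_zero b).symm)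
    exact congrArg Subtype.val this

/-! ## §4 The hypotheses `h : IsSES f g`, `hg` are met by any pinned transition (the module-level short exact sequence) -/

/-- **The level sequence `0 → T^{(i)} →ι T^{(j)} →redLE T^{(i')} → 0` IS a short exact sequence of discrete `Γ_K`-modules**
for a pinned transition `ι` (`ι ∘ redLE = π^{e_j−e_i}`) whenever `e_i + e_{i'} = e_j` (full tower: `(i, j, i') = (0, t+1, t)`):
the hypothesis `h : IsSES f g` of §1–§3 (with `hg := fun _ => rfl`), from `injective_of_comp_redLE_eq`,
`redLE_eq_zero_iff_mem_range_of_comp_redLE_eq` and the surjectivity of `redLE`.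
[cite: Howard2004HeegnerKolyvagin, §1.4 displays (1)(2) and §1.6 (arXiv:1202.6340 p. 8 L22–30, p. 11 L33–38)]
[cite: SerreGaloisCohomology1997, Ch. I §2.2] -/
theorem isSES_of_comp_redLE_eq (S : DVRSetting p K R N Rk Nbar Nq) (hy : S.SatisfiesH) {i i' j : ℕ} (hij : i ≤ j)
    (hi'j : i' ≤ j) (he : S.e i + S.e i' = S.e j) (ι : N i →ₗ[R] N j)
    (hιg : ∀ (g : absoluteGaloisGroup K) (x : N i), ι (S.T.ρ i g x) = S.T.ρ j g (ι x))
    (hι : ∀ y : N j, ι (S.T.redLE hij y) = S.π ^ (S.e j - S.e i) • y) :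
    IsSES
      (TopRep.ofHom ⟨⟨ι.toAddMonoidHom.toIntLinearMap, continuous_of_discreteTopology⟩,
        fun g => ContinuousLinearMap.ext fun x => hιg g x⟩ : (S.T.ρ i).toTopRep ⟶ (S.T.ρ j).toTopRep)
      (TopRep.ofHom ⟨⟨(S.T.redLE hi'j).toAddMonoidHom.toIntLinearMap, continuous_of_discreteTopology⟩,
        fun g => ContinuousLinearMap.ext fun x => S.T.redLE_equivariant hi'j g x⟩ :
          (S.T.ρ j).toTopRep ⟶ (S.T.ρ i').toTopRep) :=
  { comp_eq_zero := by
      ext x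
      exact (S.redLE_eq_zero_iff_mem_range_of_comp_redLE_eq hy hij hi'j he ι hι (ι x)).2 ⟨x, rfl⟩
    injective := S.injective_of_comp_redLE_eq hy hij ι hι
    exact_mid := fun y hy0 => (S.redLE_eq_zero_iff_mem_range_of_comp_redLE_eq hy hij hi'j he ι hι y).1 hy0
    surjective := S.T.redLE_surjective hi'j }

end DVRSetting

end Literature.NumberTheory.GaloisCohomology.Howard2004

end
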